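import Literature.AlgebraicGeometry.Frobenioids.KummerLocalDualityBinding
import Literature.AlgebraicGeometry.Frobenioids.PadicKummerIsoTransport
import Literature.AnabelianGeometry.AbsoluteAnabelian.AbsAnabProp121viiSub
import HarnessLib

/-!
# Frobenioids II, Thm. 2.4 (ii): `F_N(A) → H²(Γ_E, μ_N(Ē))` for a layer `E` with `Γ_E ≅ H`, and its
# naturality along context isomorphisms (cell row W12, PIECE B of abc-iut-w5-d201's cut)

Mochizuki, *The geometry of Frobenioids II*, Kyushu J. Math. **62** (2008) 401–460, §2, Definition 2.2
(ii) p. 18 ("so `F_N(A) ≅ H²(H, μ_N(A)) ≅ ℤ/Nℤ`") and Theorem 2.4 (ii) p. 20 ("the isomorphism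
`F_N(A₁) ⥲ F_N(A₂)` of (i) is compatible with the natural isomorphisms `F_N(Aᵢ) ⥲ ℤ/Nℤ`"), proof
p. 21: the invariant `inv` of `F_N(A) ≅ H²(H, μ_N)` is that of the local field `E⁰ = K̄^H` ("induced on
subquotients", [NSW] 7.1.4) [cite: MochizukiFrdII2008, Thm 2.4 (ii) p.21].

PIECE B (abc-iut-L2-t12 g3, taken 03:2xZ from abc-iut-w5-d201's CUT 03:00:42Z; pieces A = L4-side
layer transport of [AbsAnab] Prop. 1.2.1 (vii), C = assembly). For the Galois-level context
`X = Def22Context.ofGalois L H hH res res_smul` (abc-iut-L1-t7) with `m : MuModel L O N`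
(`μ_N(A) ≅ μ_N(K̄)` `G_K`-equivariantly) and an ABSTRACT finite layer `E/K` with
`hHE : H = Gal(K̄/ι⁻¹E)` (`galFixing K (embField K E)`):
* `layerHom` — `Γ_E → H`, `σ ↦ σ|_{K̄}` (`absGaloisRestrict`), a continuous bijection onto `H` with
  continuous inverse `layerInv` (`liftGalHom`);
* `layerMuEquiv` — `μ_N(K̄) ≃+ μ_N(Ē)` along the chosen `K̄ ≅ Ē` (`absClosureEquiv`), `Γ_E`-equivariant
  over `layerHom` (abc-iut-w5-d207's `muCarrierEquiv`, for an abstract `E`);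
* `layerCoeff` — the coefficient morphism `μ_N(A)|_{Γ_E} → μ_N(Ē)` (through `m` and `layerMuEquiv`);
* **`fnLayerMap`** `Θ : F_N(A) →+ H²(Γ_E, μ_N(Ē))` := (restriction along `layerHom` with `layerCoeff`)
  `∘ Kummer.fnToH2`; `fnLayerMap_injective`; `fnLayerMap_bijective_of_isCohSaturated` (Def. 2.2 (ii)(c)
  ⇒ "`F_N(A) ≅ H²(H, μ_N(A))`" ≅ `H²(Γ_E, μ_N(Ē))`);
* the NATURALITY `fnLayerMap_isoFN` along `e : Iso X₁ X₂` is the sequel file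
  `PadicKummerFNLayerNaturality.lean` (≤ 400-line rule).
Combined with PIECE A (`Prop121vii.layer_residueMap_compat`, abc-iut-w5-d201) this yields the input
`hinv` of abc-iut-L1-d4's `Def22Context.Iso.thm24ii_of_invariant_compat` (PIECE C). Nothing here
concerns [IUTchIII]; classical. Universe `0`.
-/

noncomputable section

open CategoryTheory Function

namespace Literature.AlgebraicGeometry.Frobenioids

namespace PadicKummer

namespace Def22Context

open Field IntermediateField Kummer
open Literature.NumberTheory.GaloisRepresentations
open Literature.NumberTheory.GaloisRepresentations.LocalWeilDatum
open Literature.NumberTheory.GaloisRepresentations.DiscreteGaloisModule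
open Literature.AnabelianGeometry.AbsoluteAnabelian
open _root_.TopRep _root_.ContinuousCohomology

/-! ### Context-level wrapper for `F_N(A) ↪ H²(H, μ_N(A))` (the context's own instances) -/

/-- `F_N(A) ↪ H²(H, μ_N(A))` of a Definition 2.2 context (abc-iut-L1-t4's `Kummer.fnToH2` at the
context's instances — a wrapper like `FN X N`, so that it can be written at the binding `ofGalois`).
[cite: MochizukiFrdII2008, Def 2.2 (ii) p.18] -/
abbrev fnToH2Of (X : Def22Context) (N : ℕ) := Kummer.fnToH2 N X.O X.HA X.qHA

/-! ### The layer group isomorphism `Γ_E ≅ H` -/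

section Layer

variable {K : Type} [Field K] (L : IntermediateField K (AlgebraicClosure K)) [Normal K L]
  [FiniteDimensional K L]
  {AutC O : Type} [Group AutC] [CommMonoid O] [IsCancelMul O] [MulDistribMulAction AutC O]
  [MulDistribMulAction (L ≃ₐ[K] L) O] (H : Subgroup (absoluteGaloisGroup K)) [H.Normal]
  (hH : IsOpen (H : Set (absoluteGaloisGroup K))) (res : AutC →* (L ≃ₐ[K] L))
  (res_smul : ∀ (α : AutC) (x : O), res α • x = α • x)
  (E : Type) [Field E] [Algebra K E] [Algebra.IsAlgebraic K E]
  (hHE : H = galFixing K (embField K E))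

include hHE in
omit [H.Normal] in
/-- `σ|_{K̄} ∈ H` for `σ ∈ Γ_E` when `H = Gal(K̄/ι⁻¹E)`. [cite: MochizukiFrdII2008, Thm 2.4 (ii) p.21] -/
theorem absGaloisRestrict_mem_H (σ : absoluteGaloisGroup E) : absGaloisRestrict K E σ ∈ H := by
  rw [hHE]; exact absGaloisRestrict_mem_galFixing K E σ

/-- **`Γ_E → H`, `σ ↦ σ|_{K̄}`**, as a continuous homomorphism into the group `H` of the context
`ofGalois L H hH res res_smul` ("`E⁰ = K̄^H`", p. 21). [cite: MochizukiFrdII2008, Thm 2.4 (ii) p.21] -/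
def layerHom : absoluteGaloisGroup E →ₜ* (ofGalois L H hH res res_smul).H where
  toMonoidHom := (absGaloisRestrict K E : absoluteGaloisGroup E →* absoluteGaloisGroup K).codRestrict
    H (absGaloisRestrict_mem_H H E hHE)
  continuous_toFun := (absGaloisRestrict K E).continuous.subtype_mk _

/-- Unfolding `layerHom`: its value in `G_K` is the restriction.
[cite: MochizukiFrdII2008, Thm 2.4 (ii) p.21] -/
@[simp] theorem coe_layerHom (σ : absoluteGaloisGroup E) :
    ((layerHom L H hH res res_smul E hHE σ : (ofGalois L H hH res res_smul).H) :
      absoluteGaloisGroup K) = absGaloisRestrict K E σ := rfl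

include hHE in
omit [H.Normal] [Algebra.IsAlgebraic K E] in
/-- Membership transfer: `γ ∈ H` gives `γ ∈ Gal(K̄/ι⁻¹E)`. [cite: MochizukiFrdII2008, Thm 2.4 (ii) p.21] -/
theorem mem_galFixing_of_mem_H {γ : absoluteGaloisGroup K} (hγ : γ ∈ H) :
    γ ∈ galFixing K (embField K E) := hHE ▸ hγ

/-- The inverse `H → Γ_E` (`liftGal`), as a homomorphism. [cite: MochizukiFrdII2008, Thm 2.4 (ii) p.21] -/
def layerInvHom : (ofGalois L H hH res res_smul).H →* absoluteGaloisGroup E where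
  toFun h := liftGal K E (mem_galFixing_of_mem_H H E hHE h.2)
  map_one' := absGaloisRestrict_injective K E (by
    rw [absGaloisRestrict_liftGal, map_one]; rfl)
  map_mul' h h' := absGaloisRestrict_injective K E (by
    rw [absGaloisRestrict_liftGal, map_mul, absGaloisRestrict_liftGal, absGaloisRestrict_liftGal]; rfl)

/-- `layerInvHom ∘ layerHom = id`. [cite: MochizukiFrdII2008, Thm 2.4 (ii) p.21] -/
theorem layerInvHom_layerHom (σ : absoluteGaloisGroup E) :
    layerInvHom L H hH res res_smul E hHE (layerHom L H hH res res_smul E hHE σ) = σ :=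
  liftGal_absGaloisRestrict K E σ
    (mem_galFixing_of_mem_H H E hHE (absGaloisRestrict_mem_H H E hHE σ))

/-- `layerHom ∘ layerInvHom = id`. [cite: MochizukiFrdII2008, Thm 2.4 (ii) p.21] -/
theorem layerHom_layerInvHom (h : (ofGalois L H hH res res_smul).H) :
    layerHom L H hH res res_smul E hHE (layerInvHom L H hH res res_smul E hHE h) = h :=
  Subtype.ext (absGaloisRestrict_liftGal K E (mem_galFixing_of_mem_H H E hHE h.2))

/-- `H → Γ_E` is continuous (inverse of a continuous bijection from the compact `Γ_E` onto the
Hausdorff `H`), for `K` of characteristic `0`. [cite: MochizukiFrdII2008, Thm 2.4 (ii) p.21] -/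
theorem continuous_layerInvHom [CharZero K] : Continuous (layerInvHom L H hH res res_smul E hHE) := by
  haveI : CharZero E := charZero_of_injective_algebraMap (algebraMap K E).injective
  let eq : absoluteGaloisGroup E ≃ (ofGalois L H hH res res_smul).H :=
    { toFun := layerHom L H hH res res_smul E hHE
      invFun := layerInvHom L H hH res res_smul E hHE
      left_inv := layerInvHom_layerHom L H hH res res_smul E hHE
      right_inv := layerHom_layerInvHom L H hH res res_smul E hHE }
  have he : Continuous eq := (layerHom L H hH res res_smul E hHE).continuous
  exact (he.homeoOfEquivCompactToT2 (f := eq)).symm.continuous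

/-- `H → Γ_E` as a continuous homomorphism. [cite: MochizukiFrdII2008, Thm 2.4 (ii) p.21] -/
def layerInv [CharZero K] : (ofGalois L H hH res res_smul).H →ₜ* absoluteGaloisGroup E :=
  ⟨layerInvHom L H hH res res_smul E hHE, continuous_layerInvHom L H hH res res_smul E hHE⟩

/-! ### The coefficient isomorphism `μ_N(K̄) ≅ μ_N(Ē)` for an abstract layer -/

variable (N : ℕ)

/-- `μ_N(K̄) ⥲ μ_N(Ē)` on additive carriers, along the chosen `K̄ ≅ Ē` (abc-iut-w5-d207's
`muCarrierEquiv`, for an abstract finite `E/K`). [cite: MochizukiFrdII2008, Thm 2.4 (ii) p.21] -/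
def layerMuEquiv : MuCarrier K N ≃+ MuCarrier E N :=
  (MuCarrier.toAdditive (K := K) (n := N)).trans
    ((MulEquiv.toAdditive
      ((absClosureEquiv K E).toRingEquiv.toMulEquiv.restrictRootsOfUnity N)).trans
      (MuCarrier.toAdditive (K := E) (n := N)).symm)

/-- On underlying elements, `layerMuEquiv` is the chosen embedding `K̄ → Ē`.
[cite: MochizukiFrdII2008, Thm 2.4 (ii) p.21] -/
theorem coe_layerMuEquiv (y : MuCarrier K N) :
    (((MuCarrier.toAdditive (layerMuEquiv E N y)).toMul : (AlgebraicClosure E)ˣ) : AlgebraicClosure E) =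
      absClosureEmbedding K E (((MuCarrier.toAdditive y).toMul : (AlgebraicClosure K)ˣ) :
        AlgebraicClosure K) := rfl

/-- **`Γ_E`-equivariance of `μ_N(K̄) ⥲ μ_N(Ē)`** over the restriction `Γ_E → Γ_K`.
[cite: MochizukiFrdII2008, Thm 2.4 (ii) p.21] -/
theorem layerMuEquiv_smul (σ : absoluteGaloisGroup E) (y : MuCarrier K N) :
    layerMuEquiv E N (mu K N (absGaloisRestrict K E σ) y) = mu E N σ (layerMuEquiv E N y) := by
  apply (MuCarrier.toAdditive (K := E) (n := N)).injective
  apply Additive.toMul.injective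
  refine Subtype.ext (Units.ext ?_)
  rw [mu_apply_apply (K := E), toMul_ofMul, absoluteGaloisGroup.coe_smul_rootsOfUnity,
    Units.coe_smul, coe_layerMuEquiv, coe_layerMuEquiv, mu_apply_apply, toMul_ofMul,
    absoluteGaloisGroup.coe_smul_rootsOfUnity, Units.coe_smul, absGaloisRestrict_apply_smul]

/-! ### The coefficient morphism and `Θ : F_N(A) → H²(Γ_E, μ_N(Ē))` -/

variable {N} (m : MuModel L O N)

/-- `μ_N(K̄)|_{Γ_E} → μ_N(Ē)` over `layerHom` (the `Γ_E`-equivariant `layerMuEquiv`), as a morphism of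
topological `Γ_E`-modules. [cite: MochizukiFrdII2008, Thm 2.4 (ii) p.21] -/
def layerMuHom :
    TopRep.res (layerHom L H hH res res_smul E hHE : absoluteGaloisGroup E →* (ofGalois L H hH res res_smul).H)
        (((mu K N).restrict (subgroupIncl H)).toTopRep) ⟶ (mu E N).toTopRep :=
  TopRep.ofHom
    ⟨{ (layerMuEquiv E N).toIntLinearEquiv.toLinearMap with
        cont := continuous_of_discreteTopology },
      fun σ => by
        ext y
        change layerMuEquiv E N (mu K N (absGaloisRestrict K E σ) y) = mu E N σ (layerMuEquiv E N y)
        exact layerMuEquiv_smul E N σ y⟩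

/-- **The coefficient morphism `μ_N(A)|_{Γ_E} → μ_N(Ē)`**: `μ_N(A) ≅ μ_N(K̄)` (the model `m`,
abc-iut-L1-d4's `muCoeffIso`) restricted to `Γ_E`, followed by `μ_N(K̄) ≅ μ_N(Ē)`.
[cite: MochizukiFrdII2008, Thm 2.4 (ii) p.21] -/
def layerCoeff :
    TopRep.res (layerHom L H hH res res_smul E hHE : absoluteGaloisGroup E →* (ofGalois L H hH res res_smul).H)
        (TopRep.res ((ofGalois L H hH res res_smul).qHA :
            (ofGalois L H hH res res_smul).H →* (ofGalois L H hH res res_smul).HA)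
          (muTopRep N O (ofGalois L H hH res res_smul).HA)) ⟶ (mu E N).toTopRep :=
  (TopRep.resFunctor (layerHom L H hH res res_smul E hHE :
      absoluteGaloisGroup E →* (ofGalois L H hH res res_smul).H)).map
      (muCoeffIso L O H hH res res_smul m).hom ≫ layerMuHom L H hH res res_smul E hHE

/-- `layerCoeff` on elements: `ζ ↦ layerMuEquiv (m ζ)`. [cite: MochizukiFrdII2008, Thm 2.4 (ii) p.21] -/
theorem layerCoeff_apply (x : Additive (Mu N O)) :
    (layerCoeff L H hH res res_smul E hHE m).hom x = layerMuEquiv E N (m.toContinuousLinearEquiv x) := rfl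

/-- **`Θ : F_N(A) →+ H²(Γ_E, μ_N(Ē))`** — `F_N(A) ↪ H²(H, μ_N(A))` (`Kummer.fnToH2`) followed by the
restriction along `Γ_E ⥲ H` with coefficients `μ_N(A) ≅ μ_N(Ē)`: the identification
"`F_N(A) ≅ H²(H, μ_N(A))`" of Def. 2.2 (ii) read in the Galois cohomology of the local field `E ≅ K̄^H`,
where the canonical invariant lives (proof of Thm. 2.4 (ii), p. 21). [cite: MochizukiFrdII2008, Thm 2.4 (ii) p.21] -/
def fnLayerMap : FN (ofGalois L H hH res res_smul) N →+ galoisCohomology (mu E N) 2 :=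
  (ContinuousCohomology.map (layerHom L H hH res res_smul E hHE)
      (layerCoeff L H hH res res_smul E hHE m) 2).hom.toLinearMap.toAddMonoidHom.comp
    (fnToH2Of (ofGalois L H hH res res_smul) N)

/-- Unfolding `fnLayerMap`. [cite: MochizukiFrdII2008, Thm 2.4 (ii) p.21] -/
theorem fnLayerMap_apply (x : FN (ofGalois L H hH res res_smul) N) :
    fnLayerMap L H hH res res_smul E hHE m x =
      (ContinuousCohomology.map (layerHom L H hH res res_smul E hHE)
        (layerCoeff L H hH res res_smul E hHE m) 2).hom
        (fnToH2Of (ofGalois L H hH res res_smul) N x) := rfl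

/-! ### `Θ` is injective, and bijective under Definition 2.2 (ii)(c) -/

/-- The inverse coefficient morphism `μ_N(Ē)|_H → μ_N(K̄)|_H` over `layerInv`.
[cite: MochizukiFrdII2008, Thm 2.4 (ii) p.21] -/
def layerMuInv [CharZero K] :
    TopRep.res (layerInv L H hH res res_smul E hHE : (ofGalois L H hH res res_smul).H →* absoluteGaloisGroup E)
        (mu E N).toTopRep ⟶ ((mu K N).restrict (subgroupIncl H)).toTopRep :=
  TopRep.ofHom
    ⟨{ (layerMuEquiv E N).symm.toIntLinearEquiv.toLinearMap with
        cont := continuous_of_discreteTopology },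
      fun h => by
        ext ξ
        change (layerMuEquiv E N).symm (mu E N (layerInvHom L H hH res res_smul E hHE h) ξ) =
          mu K N ((h : (ofGalois L H hH res res_smul).H) : absoluteGaloisGroup K) ((layerMuEquiv E N).symm ξ)
        apply (layerMuEquiv E N).injective
        rw [AddEquiv.apply_symm_apply]
        conv_rhs => rw [show ((h : (ofGalois L H hH res res_smul).H) : absoluteGaloisGroup K) =
            absGaloisRestrict K E (layerInvHom L H hH res res_smul E hHE h) from
          (absGaloisRestrict_liftGal K E (mem_galFixing_of_mem_H H E hHE h.2)).symm]
        rw [layerMuEquiv_smul, AddEquiv.apply_symm_apply]⟩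

/-- The inverse coefficient morphism `μ_N(Ē)|_H → μ_N(A)|_H` over `layerInv`.
[cite: MochizukiFrdII2008, Thm 2.4 (ii) p.21] -/
def layerCoeffInv [CharZero K] :
    TopRep.res (layerInv L H hH res res_smul E hHE : (ofGalois L H hH res res_smul).H →* absoluteGaloisGroup E)
        (mu E N).toTopRep ⟶
      TopRep.res ((ofGalois L H hH res res_smul).qHA :
          (ofGalois L H hH res res_smul).H →* (ofGalois L H hH res res_smul).HA)
        (muTopRep N O (ofGalois L H hH res res_smul).HA) :=
  layerMuInv L H hH res res_smul E hHE ≫ (muCoeffIso L O H hH res res_smul m).inv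

/-- `(restriction along Γ_E ⥲ H) ≫ (restriction along H ⥲ Γ_E) = 𝟙` on `Hⁿ`.
[cite: MochizukiFrdII2008, Thm 2.4 (ii) p.21] -/
theorem map_layer_comp_inv [CharZero K] (n : ℕ) :
    ContinuousCohomology.map (layerHom L H hH res res_smul E hHE) (layerCoeff L H hH res res_smul E hHE m) n ≫
      ContinuousCohomology.map (layerInv L H hH res res_smul E hHE) (layerCoeffInv L H hH res res_smul E hHE m) n =
      𝟙 _ := by
  rw [← ContinuousCohomology.map_comp]
  refine contMap_eq_id _ _ (ContinuousMonoidHom.ext fun h => layerHom_layerInvHom L H hH res res_smul E hHE h)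
    (fun x => ?_) n
  change (muCoeffIso L O H hH res res_smul m).inv.hom
      ((layerMuEquiv E N).symm (layerMuEquiv E N ((muCoeffIso L O H hH res res_smul m).hom.hom x))) = x
  rw [AddEquiv.symm_apply_apply]
  exact congrArg (fun φ => φ.hom x) (muCoeffIso L O H hH res res_smul m).hom_inv_id

/-- `(restriction along H ⥲ Γ_E) ≫ (restriction along Γ_E ⥲ H) = 𝟙` on `Hⁿ`.
[cite: MochizukiFrdII2008, Thm 2.4 (ii) p.21] -/
theorem map_inv_comp_layer [CharZero K] (n : ℕ) :
    ContinuousCohomology.map (layerInv L H hH res res_smul E hHE) (layerCoeffInv L H hH res res_smul E hHE m) n ≫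
      ContinuousCohomology.map (layerHom L H hH res res_smul E hHE) (layerCoeff L H hH res res_smul E hHE m) n =
      𝟙 _ := by
  rw [← ContinuousCohomology.map_comp]
  refine contMap_eq_id _ _ (ContinuousMonoidHom.ext fun σ => layerInvHom_layerHom L H hH res res_smul E hHE σ)
    (fun ξ => ?_) n
  change layerMuEquiv E N ((muCoeffIso L O H hH res res_smul m).hom.hom
      ((muCoeffIso L O H hH res res_smul m).inv.hom ((layerMuEquiv E N).symm ξ))) = ξ
  rw [show (muCoeffIso L O H hH res res_smul m).hom.hom
        ((muCoeffIso L O H hH res res_smul m).inv.hom ((layerMuEquiv E N).symm ξ)) = (layerMuEquiv E N).symm ξ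
      from congrArg (fun φ => φ.hom ((layerMuEquiv E N).symm ξ))
        (muCoeffIso L O H hH res res_smul m).inv_hom_id,
    AddEquiv.apply_symm_apply]

/-- The restriction `Hⁿ(H, μ_N(A)) → Hⁿ(Γ_E, μ_N(Ē))` along `Γ_E ⥲ H` with `μ_N(A) ≅ μ_N(Ē)` is
bijective. [cite: MochizukiFrdII2008, Thm 2.4 (ii) p.21] -/
theorem map_layer_bijective [CharZero K] (n : ℕ) :
    Function.Bijective (ContinuousCohomology.map (layerHom L H hH res res_smul E hHE)
      (layerCoeff L H hH res res_smul E hHE m) n).hom := by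
  refine Function.bijective_iff_has_inverse.mpr
    ⟨(ContinuousCohomology.map (layerInv L H hH res res_smul E hHE)
      (layerCoeffInv L H hH res res_smul E hHE m) n).hom, fun x => ?_, fun y => ?_⟩
  · exact congrArg (fun φ => φ.hom x) (map_layer_comp_inv L H hH res res_smul E hHE m n)
  · exact congrArg (fun φ => φ.hom y) (map_inv_comp_layer L H hH res res_smul E hHE m n)

/-- `F_N(A) ↪ H²(H, μ_N(A))` of a context is injective (abc-iut-L1-t4's `fnToH2_injective`, at the
context's instances). [cite: MochizukiFrdII2008, Def 2.2 (ii) p.18] -/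
theorem fnToH2Of_injective (X : Def22Context) (N : ℕ) : Function.Injective (fnToH2Of X N) :=
  fnToH2_injective N X.O X.HA X.qHA

/-- Under condition (c) (`IsNHSaturated`), `F_N(A) → H²(H, μ_N(A))` of a context is surjective.
[cite: MochizukiFrdII2008, Def 2.2 (ii) p.18] -/
theorem fnToH2Of_surjective (X : Def22Context) (N : ℕ) (hc : IsNHSaturated X N) :
    Function.Surjective (fnToH2Of X N) := fun y => by
  obtain ⟨x, hx⟩ := hc.cohSaturated.surjective_two_mu y
  exact ⟨x, by rw [fnToH2Of, fnToH2_mk, hx]⟩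

/-- **`Θ` is injective** (`F_N(A) ↪ H²(H, μ_N(A))` is, and the layer restriction is bijective).
[cite: MochizukiFrdII2008, Thm 2.4 (ii) p.21] -/
theorem fnLayerMap_injective [CharZero K] :
    Function.Injective (fnLayerMap L H hH res res_smul E hHE m) :=
  (map_layer_bijective L H hH res res_smul E hHE m 2).1.comp
    (fnToH2Of_injective (ofGalois L H hH res res_smul) N)

/-- **`Θ` is bijective for an `(N, H)`-saturated `A`** (the `H²`-clause of Definition 2.2 (ii)(c):
"`F_N(A) ≅ H²(H, μ_N(A))`" ≅ `H²(Γ_E, μ_N(Ē))`). [cite: MochizukiFrdII2008, Def 2.2 (ii) p.18] -/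
theorem fnLayerMap_bijective_of_isNHSaturated [CharZero K]
    (hc : IsNHSaturated (ofGalois L H hH res res_smul) N) :
    Function.Bijective (fnLayerMap L H hH res res_smul E hHE m) :=
  ⟨fnLayerMap_injective L H hH res res_smul E hHE m,
    (map_layer_bijective L H hH res res_smul E hHE m 2).2.comp
      (fnToH2Of_surjective (ofGalois L H hH res res_smul) N hc)⟩

end Layer

end Def22Context

end PadicKummer

end Literature.AlgebraicGeometry.Frobenioids

end
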